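import Mathlib
import Summits.ResolutionOfSingularities.ResolutionOfSingularities.Theorems.RadicialJungCleanModelsLens5TFrameTwoField1
import HarnessLib

/-!
# Route `RadicialJung`, crux `CleanModels` (stmt-15917): T″ port part 5/10 — §E∞ two-field M-side, part 2 (`exists_twist_model₂`, `centre_closed_and_dim_three_of_pow_mem₂`)

PORT (line lead `res-B-lead-1` g8, for Sketch rev 33) of res-B-lens-5's crux workfiles `Cruxes/DescentPerfectToAll/Lens5_TPrimeInfCurrency.lean` rev 4
(crux 75ffdaa75b27; author res-B-lens-5 g14), the T″ theorem module prepared by the author from `Lens5_TPrimeInf.lean` rev 3 (HOME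
`B/res-B-lens-5/g14/PORTALPHA_TPrimeInf_theorem_module.lean`, sha16 48c5cb0bf6ec7b34, certified by the author's one-file simulation) and
`Cruxes/DescentPerfectToAll/Lens5_TPrimeConst.lean` rev 1 (4e5e6a0028c2): THEOREMS T′_∞ / T″ / T‴ — the slice {`[Γ:pΓ] = p²`, `K/k′` separably
generated and `κ_v/k′` SEPARABLE for some finite intermediate field of constants `k ⊆ k′ ⊆ K`} of the research stub `stub_cleanLU3DefectNonDiscrete`
(grounds of ARBITRARY, possibly infinite, `p`-rank), modulo F-02 `CossartPiltant2019` and F-32 (`hEmb`) only.  Continues the T⁗-family port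
(`…Lens5TFrame{Currency,…,PDegreeC}`): same namespace `Summit.ResolutionOfSingularities.ResolutionOfSingularities.Theorems.RadicialJungCleanModels.Lens5TFrame`,
declarations VERBATIM; the authors' copies of §B/§B′ (defs) and §C/§D (RG/IR lemmas) are NOT repeated — they are the landed `…Lens5TFrameCurrency` /
`…Lens5TFrameRG` / `…Lens5TFrameIR` declarations of the same names and statements; §C′/§B‴ (unused bridges) and the T′_fin/T′₁/«T″ ⊇ T» corollaries are not ported.
OURS · counted 0 · nothing here proves resolution in characteristic `p`.


-/

set_option linter.dupNamespace false -- mandated namespace of this single-conjunct summit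

noncomputable section

section

open IsLocalRing
open Literature.AlgebraicGeometry.Resolution
open Summit.ResolutionOfSingularities.ResolutionOfSingularities.Theorems.RadicialJung.CleanModels
open Summit.ResolutionOfSingularities.ResolutionOfSingularities.Theorems.RadicialJung.CleanModels.Lens5
open Summit.ResolutionOfSingularities.ResolutionOfSingularities.Theorems.RadicialJung.CleanModels.Lens5.PRankTwoCurrency
open Summit.ResolutionOfSingularities.ResolutionOfSingularities.Theorems.RadicialJung.CleanModels.Lens5.PRankTwoAssembly
open Summit.ResolutionOfSingularities.ResolutionOfSingularities.Theorems.RadicialJungCleanModels.Lens5RegularityCriterion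
open Summit.ResolutionOfSingularities.ResolutionOfSingularities.Theorems.RadicialJungCleanModels.Lens5ChartSurjection

namespace Summit.ResolutionOfSingularities.ResolutionOfSingularities.Theorems.RadicialJungCleanModels.Lens5TFrame

namespace TwoField

variable {k₀ : Type} [Field k₀] {k : Type} [Field k] {K : Type} [Field K]
  [Algebra k₀ k] [Algebra k₀ K] [Algebra k K] [IsScalarTower k₀ k K]

/-- **§2 over the small field, assembled**: customer data on the `k`-side + F-02 `.lu3` at `k₀` give, on the twist field
`k₀(t^p ∪ {g₁})`, a finitely generated `k₀`-model `A' ⊇ k₀[t^p, g₁]` inside `O` whose localisation at the centre satisfies every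
hypothesis of F-32 (regular, excellent, `dim = 3`, inside `O`, dominated). [folklore] -/
theorem exists_twist_model₂ (p : ℕ) [Fact p.Prime] [CharP K p]
    (hFrob : ∀ c : k, ∃ c₀ : k₀, algebraMap k₀ K c₀ = algebraMap k K c ^ p)
    (hLU : LocalUniformization3 k₀) (O : ValuationSubring K)
    (A : Subalgebra k K) (hAO : A.toSubring ≤ O.toSubring) (hAfg : A.FG) [IsFractionRing A K] (hdimA : ringKrullDim A = 3)
    (t : Finset K) (ht : Algebra.adjoin k (t : Set K) = A)
    (hzd : ∀ (T : Subring K) (hT : T ≤ O.toSubring), A.toSubring ≤ T → (subringCentre T O hT).IsMaximal)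
    (g₁ : K) (hg₁ : g₁ ∈ O) (S : Set K) (hS : S = (fun x : K => x ^ p) '' (t : Set K) ∪ {g₁}) :
    ∃ (A' : Subalgebra k₀ (IntermediateField.adjoin k₀ S)),
      A'.toSubring ≤ (O.comap (algebraMap (IntermediateField.adjoin k₀ S) K)).toSubring ∧
      Algebra.adjoin k₀ ((Subtype.val : IntermediateField.adjoin k₀ S → K) ⁻¹' S) ≤ A' ∧ A'.FG ∧
      ∃ _ : IsRegularLocalRing (locAtCentre A'.toSubring (O.comap (algebraMap (IntermediateField.adjoin k₀ S) K))),
        IsExcellentRing (locAtCentre A'.toSubring (O.comap (algebraMap (IntermediateField.adjoin k₀ S) K))) ∧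
        ringKrullDim (locAtCentre A'.toSubring (O.comap (algebraMap (IntermediateField.adjoin k₀ S) K))) = 3 ∧
        (∀ r : locAtCentre A'.toSubring (O.comap (algebraMap (IntermediateField.adjoin k₀ S) K)),
          algebraMap (IntermediateField.adjoin k₀ S) K (r : IntermediateField.adjoin k₀ S) ∈ O) ∧
        (∀ r : locAtCentre A'.toSubring (O.comap (algebraMap (IntermediateField.adjoin k₀ S) K)),
          r ∈ IsLocalRing.maximalIdeal _ ↔
            O.valuation (algebraMap (IntermediateField.adjoin k₀ S) K (r : IntermediateField.adjoin k₀ S)) < 1) := by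
  have hp : 0 < p := (Fact.out : p.Prime).pos
  have hSfin : S.Finite := by
    rw [hS]
    exact ((t.finite_toSet).image _).union (Set.finite_singleton _)
  have hSO : ∀ s ∈ S, s ∈ O := by
    intro s hs
    rw [hS] at hs
    rcases hs with ⟨a, ha, rfl⟩ | hs
    · have haA : a ∈ A := by rw [← ht]; exact Algebra.subset_adjoin ha
      exact (pow_mem (hAO haA) p : a ^ p ∈ O.toSubring)
    · rw [Set.mem_singleton_iff.mp hs]; exact hg₁
  have htS : (fun x : K => x ^ p) '' (t : Set K) ⊆ S := by rw [hS]; exact Set.subset_union_left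
  obtain ⟨A', h, hSA', hA'fg, hreg⟩ :=
    exists_regular_model_subfield₂ hp hFrob hLU O A hAO hAfg inferInstance hdimA.le S hSfin hSO
  obtain ⟨hmax, -, -⟩ := model_side_obligations₂ p hFrob O A hAO hAfg hdimA (t : Set K) ht hzd S htS A' h hSA' hA'fg
  have halg : Algebra.IsAlgebraic (IntermediateField.adjoin k₀ S) K :=
    TwistModel.isAlgebraic_of_pow_mem _ hp (pow_mem_intermediateField_adjoin₂ p hFrob A (t : Set K) ht S htS)
  have hdimA' : ringKrullDim A' = 3 := by rw [ringKrullDim_eq_of_adjoin_le₂ hp hFrob A hAfg S halg A' hSA' hA'fg, hdimA]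
  exact ⟨A', h, hSA', hA'fg, TwistModel.locAtCentre_port_inputs O _ A' h hA'fg hmax hreg hdimA'⟩

/-- **Closed centre and dimension `3` for a `k₀`-model containing `p`-th powers of the `k`-generators.** [folklore] -/
theorem centre_closed_and_dim_three_of_pow_mem₂ {p : ℕ} (hp : 0 < p)
    (hFrob : ∀ c : k, ∃ c₀ : k₀, algebraMap k₀ K c₀ = algebraMap k K c ^ p)
    (O : ValuationSubring K) (A : Subalgebra k K) (hAO : A.toSubring ≤ O.toSubring) (hAfg : A.FG) [IsFractionRing A K]
    (hdimA : ringKrullDim A = 3) (t : Finset K) (ht : Algebra.adjoin k (t : Set K) = A)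
    (hzd : ∀ (T : Subring K) (hT : T ≤ O.toSubring), A.toSubring ≤ T → (subringCentre T O hT).IsMaximal)
    (A₂ : Subalgebra k₀ K) (hA₂O : A₂.toSubring ≤ O.toSubring) (hA₂fg : A₂.FG) (hAp : ∀ a ∈ (t : Set K), a ^ p ∈ A₂) :
    (subringCentre A₂.toSubring O hA₂O).IsMaximal ∧ ringKrullDim A₂ = 3 ∧ ringKrullDim (locAtCentre A₂.toSubring O) = 3 := by
  classical
  have hk : ∀ c : k, algebraMap k K c ∈ O := fun c => hAO (A.algebraMap_mem c)
  have htA : ∀ a ∈ (t : Set K), a ∈ A := fun a ha => by rw [← ht]; exact Algebra.subset_adjoin ha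
  have hkA₂ : ∀ c : k, algebraMap k K c ^ p ∈ A₂ := fun c => by
    obtain ⟨c₀, hc₀⟩ := hFrob c; rw [← hc₀]; exact A₂.algebraMap_mem c₀
  obtain ⟨G, hG⟩ := id hA₂fg
  have hGA₂ : ∀ g ∈ (G : Set K), g ∈ A₂ := fun g hg => by rw [← hG]; exact Algebra.subset_adjoin hg
  let C : Subalgebra k K := Algebra.adjoin k ((G : Set K) ∪ ↑t)
  have hCfg : C.FG := ⟨G ∪ t, by rw [Finset.coe_union]⟩
  have hA₂C : A₂.toSubring ≤ C.toSubring := by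
    intro x hx
    have hx' : x ∈ Algebra.adjoin k₀ (G : Set K) := by rw [hG]; exact hx
    change x ∈ C
    clear hx
    induction hx' using Algebra.adjoin_induction with
    | mem x hx => exact Algebra.subset_adjoin (Or.inl hx)
    | algebraMap r => rw [IsScalarTower.algebraMap_apply k₀ k K]; exact C.algebraMap_mem _
    | add x y _ _ hx hy => exact add_mem hx hy
    | mul x y _ _ hx hy => exact mul_mem hx hy
  have hAC : A ≤ C := by
    intro x hx
    rw [← ht] at hx
    exact Algebra.adjoin_mono Set.subset_union_right hx
  have hCO : C.toSubring ≤ O.toSubring := by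
    intro x hx
    rw [Subalgebra.mem_toSubring] at hx
    change x ∈ O
    induction hx using Algebra.adjoin_induction with
    | mem x hx =>
        rcases hx with hx | hx
        · exact hA₂O (hGA₂ x hx)
        · exact hAO (htA x hx)
    | algebraMap r => exact hk r
    | add x y _ _ hx hy => exact O.add_mem _ _ hx hy
    | mul x y _ _ hx hy => exact O.mul_mem _ _ hx hy
  have hmaxC : (subringCentre C.toSubring O hCO).IsMaximal := hzd C.toSubring hCO (fun x hx => hAC hx)
  letI algAC : Algebra A₂.toSubring C.toSubring := (Subring.inclusion hA₂C).toAlgebra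
  have hinj : Function.Injective (algebraMap A₂.toSubring C.toSubring) := fun a b hab =>
    Subtype.ext (congrArg Subtype.val hab :)
  haveI hintAC : Algebra.IsIntegral A₂.toSubring C.toSubring := by
    constructor
    intro x
    let gC : C.toSubring →ₐ[A₂.toSubring] K :=
      { toRingHom := C.toSubring.subtype
        commutes' := fun b => rfl }
    have hgC : Function.Injective gC := Subtype.val_injective
    rw [← isIntegral_algHom_iff gC hgC]
    change IsIntegral A₂.toSubring (x : K)
    let IC : Subalgebra k K :=
      { carrier := {a : K | IsIntegral A₂.toSubring a}
        mul_mem' := fun ha hb => ha.mul hb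
        one_mem' := isIntegral_one
        add_mem' := fun ha hb => ha.add hb
        zero_mem' := isIntegral_zero
        algebraMap_mem' := fun r => IsIntegral.of_pow hp
          (isIntegral_algebraMap (R := A₂.toSubring) (A := K) (x := ⟨algebraMap k K r ^ p, hkA₂ r⟩)) }
    have hCle : C ≤ IC := by
      apply Algebra.adjoin_le
      rintro a (ha | ha)
      · change IsIntegral A₂.toSubring a
        exact isIntegral_algebraMap (R := A₂.toSubring) (A := K) (x := ⟨a, hGA₂ a ha⟩)
      · change IsIntegral A₂.toSubring a
        exact IsIntegral.of_pow hp (isIntegral_algebraMap (R := A₂.toSubring) (A := K) (x := ⟨a ^ p, hAp a ha⟩))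
    exact hCle x.2
  have hmaxA₂ : (subringCentre A₂.toSubring O hA₂O).IsMaximal := by
    have h1 : ((subringCentre C.toSubring O hCO).comap (algebraMap A₂.toSubring C.toSubring)).IsMaximal :=
      Ideal.isMaximal_comap_of_isIntegral_of_isMaximal _
    have h2 : (subringCentre C.toSubring O hCO).comap (algebraMap A₂.toSubring C.toSubring) =
        subringCentre A₂.toSubring O hA₂O := by
      ext a
      rw [Ideal.mem_comap, mem_subringCentre_iff, mem_subringCentre_iff]
      rfl
    rw [← h2]
    exact h1
  have hdimC : ringKrullDim C = 3 := by rw [ringKrullDim_eq_of_fg_of_le hAfg hCfg hAC, hdimA]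
  have hdimA₂ : ringKrullDim A₂ = 3 := by
    have h1 := Literature.RingTheory.KrullDimension.ringKrullDim_eq_of_isIntegral (R := A₂.toSubring) (S := C.toSubring) hinj
    change ringKrullDim A₂.toSubring = 3
    rw [h1]
    exact hdimC
  refine ⟨hmaxA₂, hdimA₂, ?_⟩
  rw [ringKrullDim_locAtCentre_eq_of_isMaximal A₂ hA₂fg O hA₂O hmaxA₂, hdimA₂]



end TwoField

end Summit.ResolutionOfSingularities.ResolutionOfSingularities.Theorems.RadicialJungCleanModels.Lens5TFrame

end
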